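import Summits.CriticalPhenomena.PercolationContinuityZ3.Theorems.PercShatteringRaceNearLinearTwoClusterDecaySplitCore
import HarnessLib

/-!
# Crux `PercShatteringRace.NearLinearTwoClusterDecay` (stmt-CriticalPhenomena-5785) — split glue: `U ⇐ PairTwoArmsDecay ∧ LongArmsAreDense`

Helper file of the lead (seat c4) of the line `pair-decay-long-arms-dense`; lands with
`--supports stmt-CriticalPhenomena-5785` (registered stubs `nearLinearTwoClusterDecay_of_subs`,
`percolationContinuityZ3_of_powerSaving_of_pairTwoArmsDecay`,
`nearLinearTwoClusterDecay_of_pairTwoArmsDecay_of_noThinWitness`; = the crux-strategist's evidence file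
`PercShatteringRaceNearLinearTwoClusterDecaySplit.lean`, which a planner seat cannot land under Theorems).

The two hypotheses of `nearLinearTwoClusterDecay_of_subs` are, VERBATIM, the two proposed route-level
sub-cruxes of stmt-5785 (`children.json` on the item):
* `PairTwoArmsDecay` — the PAIR form of `U(1/6)` (Cerf's two-arms event for a deterministic pair at
  aspect `n^{1/6}`); exactly what the route's `closes` consumes:
  `percolationContinuityZ3_of_powerSaving_of_pairTwoArmsDecay` (with `S(1/2)`, via `jumpBoxLRO_of_pairDecay`
  — Harris–FKG + first exits, `θ² ≤ P(x ↔ x' in Λ) + P(pairBad)` — and the landed `raceLemma_of_jumpBoxLRO`,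
  p125450); necessary for the crux (`pairTwoArmsDecay_of_nearLinearTwoClusterDecay`);
* `LongArmsAreDense` — every in-box arm from `Λ(n)` to `∂ⁱⁿΛ(⌈n^{7/6}⌉)` is carried by a cluster with a
  `κ`-dense `Λ(n)`-trace, w.h.p. (the `d < 6` residue; hardest).
Also certified: the LOSSLESS cut `U ↔ PairTwoArmsDecay ∧ NoThinWitness`
(`nearLinearTwoClusterDecay_iff_pair_and_noThinWitness`) and `LongArmsAreDense → NoThinWitness`
(`noThinWitness_of_longArmsAreDense`).  The density-sampling core (vocabulary `Pc`, `outer`, `pairBad`,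
`twoCluster`, `thinEvt`, `thinWitnessEvt`, Markov `pairCountBound`) is
`PercShatteringRaceNearLinearTwoClusterDecaySplitCore.lean`; this file adds the consumed side, the
bridges to the route wording, and the headline theorems.  No new mathematics (crux-strategist's
composition, kernel-checked).
-/

noncomputable section

namespace Summit.CriticalPhenomena.PercolationContinuityZ3.Theorems

namespace NearLinearTwoClusterDecaySplit

open MeasureTheory Filter Topology
open Literature.Probability.LatticeModels Literature.Probability.Percolation
open Summit.CriticalPhenomena.PercolationContinuityZ3.Theses.PercShatteringRace
open Summit.CriticalPhenomena.PercolationContinuityZ3.Theorems.NearLinearTwoClusterDecay.Consumed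

/-! ## Child 1 and the consumed side -/

/-- PAIR version of the landed `theta_sq_le_real_openConnIn_add_real_twoClusters`:
`θ(p)² ≤ P_p(x ↔ x' in Λ_R) + P_p(pairBad R x x')` for `x, x' ∈ Λ_R` (Harris–FKG for the two
increasing events `{x ↔ ∞}`, `{x' ↔ ∞}`, translation invariance of `θ`, and first exits of the two
infinite paths from `Λ_R`; no uniqueness of the infinite cluster). [folklore] -/
theorem theta_sq_le_real_openConnIn_add_real_pairBad (p : unitInterval) {R : ℕ} {x x' : Site 3}
    (hx : x ∈ box 3 R) (hx' : x' ∈ box 3 R) :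
    theta (zdGraph 3) 0 p ^ 2 ≤
      (bondPercolation (zdGraph 3) p).real (openConnIn (↑(box 3 R) : Set (Site 3)) x x') +
        (bondPercolation (zdGraph 3) p).real (pairBad R x x') := by
  calc theta (zdGraph 3) 0 p ^ 2 = theta (zdGraph 3) x p * theta (zdGraph 3) x' p := by
        rw [sq, theta_zdGraph_eq_theta_zero p x, theta_zdGraph_eq_theta_zero p x']
    _ ≤ (bondPercolation (zdGraph 3) p).real (percolatesAt x ∩ percolatesAt x') :=
        harris_fkg_holds (zdGraph 3) p (isUpperSet_percolatesAt x) (isUpperSet_percolatesAt x')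
          (measurableSet_percolatesAt_holds x) (measurableSet_percolatesAt_holds x')
    _ ≤ (bondPercolation (zdGraph 3) p).real
          (openConnIn (↑(box 3 R) : Set (Site 3)) x x' ∪ pairBad R x x') := by
        refine DCT16.real_mono_of_forall_subset_edgeSet (zdGraph 3) p fun ω hω hmem => ?_
        by_cases hc : ω ∈ openConnIn (↑(box 3 R) : Set (Site 3)) x x'
        · exact Or.inl hc
        · obtain ⟨y, hy, hxy⟩ := exists_openConnIn_innerBoundary_of_percolatesAt hx hω hmem.1
          obtain ⟨y', hy', hxy'⟩ := exists_openConnIn_innerBoundary_of_percolatesAt hx' hω hmem.2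
          exact Or.inr ⟨⟨⟨y, hy, hxy⟩, ⟨y', hy', hxy'⟩⟩, hc⟩
    _ ≤ _ := measureReal_union_le _ _

/-- Child 1 ⇒ the route's CONSUMED form (jump-world in-box LRO at aspect `1 + 1/6`, `c = θ²/2`).
Child 1 is unguarded; the jump hypothesis is only needed to make `c > 0`. [folklore] -/
theorem jumpBoxLRO_of_pairDecay (h : ∀ ε : ℝ, 0 < ε → ∀ᶠ n : ℕ in atTop, ∀ x ∈ box 3 n, ∀ x' ∈ box 3 n, Pc.real (pairBad (outer n) x x') ≤ ε) :
    0 < theta (zdGraph 3) 0 (criticalProbI 3) → ∃ c : ℝ, 0 < c ∧ ∀ᶠ n : ℕ in atTop, ∀ y ∈ box 3 n,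
      c ≤ (bondPercolation (zdGraph 3) (criticalProbI 3)).real
        (openConnIn (↑(box 3 ⌈(n : ℝ) ^ (1 + 1 / 6 : ℝ)⌉₊) : Set (Site 3)) 0 y) := by
  intro hθ
  refine ⟨theta (zdGraph 3) 0 (criticalProbI 3) ^ 2 / 2, by positivity, ?_⟩
  have hε : 0 < theta (zdGraph 3) 0 (criticalProbI 3) ^ 2 / 2 := by positivity
  filter_upwards [h _ hε] with n hn y hy
  have e : (1 + 1 / 6 : ℝ) = (7 : ℝ) / 6 := by norm_num
  rw [e]
  have hle : n ≤ outer n := le_nat_ceil_rpow (by norm_num : (1 : ℝ) ≤ 7 / 6) n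
  have h1 := theta_sq_le_real_openConnIn_add_real_pairBad (criticalProbI 3)
    (box_mono 3 hle (zero_mem_box 3 n)) (box_mono 3 hle hy)
  have h2 := hn 0 (zero_mem_box 3 n) y hy
  show theta (zdGraph 3) 0 (criticalProbI 3) ^ 2 / 2 ≤
    Pc.real (openConnIn (↑(box 3 (outer n)) : Set (Site 3)) 0 y)
  linarith

/-- Necessity of child 1: the crux (union form) implies the pair form, since for `x, x' ∈ Λ(n)`
the pair event is contained in the crux event. [folklore] -/
theorem pairDecay_of_tendsto (h : Tendsto (fun n : ℕ => Pc.real (twoCluster n (outer n))) atTop (𝓝 0)) :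
    ∀ ε : ℝ, 0 < ε → ∀ᶠ n : ℕ in atTop, ∀ x ∈ box 3 n, ∀ x' ∈ box 3 n, Pc.real (pairBad (outer n) x x') ≤ ε := by
  intro ε hε
  have hev : ∀ᶠ n : ℕ in atTop, Pc.real (twoCluster n (outer n)) < ε :=
    (tendsto_order.1 h).2 ε hε
  filter_upwards [hev] with n hn x hx x' hx'
  refine le_trans (measureReal_mono ?_) hn.le
  exact fun ω hω => ⟨x, hx, x', hx', hω⟩

/-! ## Bridges from the route-item wording to the file-local vocabulary -/

/-- Child 1 as rendered in the route file is the pair decay in the file-local vocabulary. [folklore] -/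
theorem pairDecay_iff :
    (∀ ε : ℝ, 0 < ε → ∀ᶠ n : ℕ in atTop, ∀ x ∈ box 3 n, ∀ x' ∈ box 3 n, Pc.real (pairBad (outer n) x x') ≤ ε) ↔ ∀ ε : ℝ, 0 < ε → ∀ᶠ n : ℕ in atTop, ∀ x ∈ box 3 n, ∀ x' ∈ box 3 n,
      (bondPercolation (zdGraph 3) (criticalProbI 3)).real
        {ω | ∃ y ∈ innerBoundary (zdGraph 3) (box 3 ⌈(n : ℝ) ^ ((7 : ℝ) / 6)⌉₊),
          ∃ y' ∈ innerBoundary (zdGraph 3) (box 3 ⌈(n : ℝ) ^ ((7 : ℝ) / 6)⌉₊),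
            ω ∈ openConnIn ↑(box 3 ⌈(n : ℝ) ^ ((7 : ℝ) / 6)⌉₊) x y ∧
            ω ∈ openConnIn ↑(box 3 ⌈(n : ℝ) ^ ((7 : ℝ) / 6)⌉₊) x' y' ∧
            ω ∉ openConnIn ↑(box 3 ⌈(n : ℝ) ^ ((7 : ℝ) / 6)⌉₊) x x'} ≤ ε := by
  simp only [pairBad_eq, outer]

/-- Child 2's event as rendered in the route file is `thinEvt n (outer n) κ`. [folklore] -/
theorem thinEvt_eq (n : ℕ) (κ : ℝ) : thinEvt n (outer n) κ =
    {ω | ∃ x ∈ box 3 n,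
      (∃ y ∈ innerBoundary (zdGraph 3) (box 3 ⌈(n : ℝ) ^ ((7 : ℝ) / 6)⌉₊),
        ω ∈ openConnIn ↑(box 3 ⌈(n : ℝ) ^ ((7 : ℝ) / 6)⌉₊) x y) ∧
      (Set.ncard {z : Site 3 | z ∈ box 3 n ∧ ω ∈ openConnIn ↑(box 3 ⌈(n : ℝ) ^ ((7 : ℝ) / 6)⌉₊) x z} : ℝ)
        < κ * (box 3 n).card} := by
  ext ω
  simp only [thinEvt, reachesOut, outer, Set.mem_setOf_eq, ncard_eq_card_trace]

/-- The residue's event as rendered (route wording) is `thinWitnessEvt n (outer n) κ`. [folklore] -/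
theorem thinWitnessEvt_eq (n : ℕ) (κ : ℝ) : thinWitnessEvt n (outer n) κ =
    {ω | ∃ x ∈ box 3 n, ∃ x' ∈ box 3 n,
      (∃ y ∈ innerBoundary (zdGraph 3) (box 3 ⌈(n : ℝ) ^ ((7 : ℝ) / 6)⌉₊),
        ∃ y' ∈ innerBoundary (zdGraph 3) (box 3 ⌈(n : ℝ) ^ ((7 : ℝ) / 6)⌉₊),
          ω ∈ openConnIn ↑(box 3 ⌈(n : ℝ) ^ ((7 : ℝ) / 6)⌉₊) x y ∧
          ω ∈ openConnIn ↑(box 3 ⌈(n : ℝ) ^ ((7 : ℝ) / 6)⌉₊) x' y' ∧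
          ω ∉ openConnIn ↑(box 3 ⌈(n : ℝ) ^ ((7 : ℝ) / 6)⌉₊) x x') ∧
      (Set.ncard {z : Site 3 | z ∈ box 3 n ∧ ω ∈ openConnIn ↑(box 3 ⌈(n : ℝ) ^ ((7 : ℝ) / 6)⌉₊) x z} : ℝ)
        < κ * (box 3 n).card} := by
  ext ω
  simp only [thinWitnessEvt, mem_pairBad_iff, outer, Set.mem_setOf_eq, ncard_eq_card_trace]

/-- **The composition with the two stub STATEMENTS inlined** (= the split glue
`Theorems.nearLinearTwoClusterDecay_of_subs` of the evidence file up to the final `Iff`; hypotheses in order =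
the two sub-items' statements verbatim, conclusion the unfolded crux event's decay).  Density sampling, no case split on `θ(p_c)`: on the crux event either a witness is
`κ`-thin (child 2's event) or both witnesses are `κ`-dense, which forces `≥ (κ|Λ(n)|)²` ordered bad
pairs in `Λ(n)²`; Markov and child 1 (with `ε κ²`) bound that by `ε`. [folklore] -/
theorem tendsto_twoCluster_of_statements
    (h₁ : ∀ ε : ℝ, 0 < ε → ∀ᶠ n : ℕ in Filter.atTop, ∀ x ∈ box 3 n, ∀ x' ∈ box 3 n,
      (bondPercolation (zdGraph 3) (criticalProbI 3)).real
        {ω | ∃ y ∈ innerBoundary (zdGraph 3) (box 3 ⌈(n : ℝ) ^ ((7 : ℝ) / 6)⌉₊),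
          ∃ y' ∈ innerBoundary (zdGraph 3) (box 3 ⌈(n : ℝ) ^ ((7 : ℝ) / 6)⌉₊),
            ω ∈ openConnIn ↑(box 3 ⌈(n : ℝ) ^ ((7 : ℝ) / 6)⌉₊) x y ∧
            ω ∈ openConnIn ↑(box 3 ⌈(n : ℝ) ^ ((7 : ℝ) / 6)⌉₊) x' y' ∧
            ω ∉ openConnIn ↑(box 3 ⌈(n : ℝ) ^ ((7 : ℝ) / 6)⌉₊) x x'} ≤ ε)
    (h₂ : ∀ ε : ℝ, 0 < ε → ∃ κ : ℝ, 0 < κ ∧ ∀ᶠ n : ℕ in Filter.atTop,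
      (bondPercolation (zdGraph 3) (criticalProbI 3)).real
        {ω | ∃ x ∈ box 3 n,
          (∃ y ∈ innerBoundary (zdGraph 3) (box 3 ⌈(n : ℝ) ^ ((7 : ℝ) / 6)⌉₊),
            ω ∈ openConnIn ↑(box 3 ⌈(n : ℝ) ^ ((7 : ℝ) / 6)⌉₊) x y) ∧
          (Set.ncard {z : Site 3 | z ∈ box 3 n ∧
              ω ∈ openConnIn ↑(box 3 ⌈(n : ℝ) ^ ((7 : ℝ) / 6)⌉₊) x z} : ℝ) < κ * (box 3 n).card} ≤ ε) :
    Tendsto (fun n : ℕ => Pc.real (twoCluster n (outer n))) atTop (𝓝 0) := by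
  have h1 := pairDecay_iff.2 h₁
  have h2 : ∀ ε : ℝ, 0 < ε → ∃ κ : ℝ, 0 < κ ∧ ∀ᶠ n : ℕ in atTop, Pc.real (thinEvt n (outer n) κ) ≤ ε := by
    intro ε hε
    obtain ⟨κ, hκ, hev⟩ := h₂ ε hε
    refine ⟨κ, hκ, ?_⟩
    filter_upwards [hev] with n hn
    rwa [thinEvt_eq]
  exact tendsto_twoCluster_of_pairDecay_of_noThinWitness' h1 (noThinWitness'_of_longArmsDense' h2)

end NearLinearTwoClusterDecaySplit

open MeasureTheory Filter Topology
open Literature.Probability.LatticeModels Literature.Probability.Percolation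
open Summit.CriticalPhenomena.PercolationContinuityZ3.Theses.PercShatteringRace
open Summit.CriticalPhenomena.PercolationContinuityZ3.Theorems.NearLinearTwoClusterDecay.Consumed
open NearLinearTwoClusterDecaySplit

/-! ## Headline theorems (registered stubs; hypotheses = the two sub-cruxes as the route renders them) -/

/-- **SPLIT GLUE `nearLinearTwoClusterDecay_of_subs`** (registered stub): the two proposed sub-cruxes of
stmt-5785 — `PairTwoArmsDecay` (`h₁`, pair form) and `LongArmsAreDense` (`h₂`, long arms are locally
dense) — imply the crux `NearLinearTwoClusterDecay` BY NAME.  Density sampling: on the crux event either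
a witness is `κ`-thin (an instance of `h₂`'s event) or both witnesses are `κ`-dense, forcing
`≥ (κ|Λ(n)|)²` ordered bad pairs of `Λ(n)`; Markov and `h₁` at `ε κ²`. [folklore] -/
theorem nearLinearTwoClusterDecay_of_subs
    (h₁ : ∀ ε : ℝ, 0 < ε → ∀ᶠ n : ℕ in Filter.atTop, ∀ x ∈ box 3 n, ∀ x' ∈ box 3 n,
      (bondPercolation (zdGraph 3) (criticalProbI 3)).real
        {ω | ∃ y ∈ innerBoundary (zdGraph 3) (box 3 ⌈(n : ℝ) ^ ((7 : ℝ) / 6)⌉₊),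
          ∃ y' ∈ innerBoundary (zdGraph 3) (box 3 ⌈(n : ℝ) ^ ((7 : ℝ) / 6)⌉₊),
            ω ∈ openConnIn ↑(box 3 ⌈(n : ℝ) ^ ((7 : ℝ) / 6)⌉₊) x y ∧
            ω ∈ openConnIn ↑(box 3 ⌈(n : ℝ) ^ ((7 : ℝ) / 6)⌉₊) x' y' ∧
            ω ∉ openConnIn ↑(box 3 ⌈(n : ℝ) ^ ((7 : ℝ) / 6)⌉₊) x x'} ≤ ε)
    (h₂ : ∀ ε : ℝ, 0 < ε → ∃ κ : ℝ, 0 < κ ∧ ∀ᶠ n : ℕ in Filter.atTop,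
      (bondPercolation (zdGraph 3) (criticalProbI 3)).real
        {ω | ∃ x ∈ box 3 n,
          (∃ y ∈ innerBoundary (zdGraph 3) (box 3 ⌈(n : ℝ) ^ ((7 : ℝ) / 6)⌉₊),
            ω ∈ openConnIn ↑(box 3 ⌈(n : ℝ) ^ ((7 : ℝ) / 6)⌉₊) x y) ∧
          (Set.ncard {z : Site 3 | z ∈ box 3 n ∧
              ω ∈ openConnIn ↑(box 3 ⌈(n : ℝ) ^ ((7 : ℝ) / 6)⌉₊) x z} : ℝ) < κ * (box 3 n).card} ≤ ε) :
    Summit.CriticalPhenomena.PercolationContinuityZ3.Theses.PercShatteringRace.NearLinearTwoClusterDecay :=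
  nearLinearTwoClusterDecay_iff_twoCluster.2 (tendsto_twoCluster_of_statements h₁ h₂)

/-- **The consumed side**: child 1 (`PairTwoArmsDecay`) together with the other crux
`S(1/2) = FreeSusceptibilityPowerSaving` already gives `θ(p_c) = 0` on `ℤ³` — through the jump-world
in-box LRO at aspect `7/6` (`jumpBoxLRO_of_pairDecay`, `c = θ²/2`) and the landed
`raceLemma_of_jumpBoxLRO` (p125450) at `(a, b) = (1/2, 1/6)`.  So a deciding theorem
`closes' (hS) (h₁ : PairTwoArmsDecay) : PercolationContinuityZ3 := <this>` is available to the
tenure planner, after which child 2 is not load-bearing for route PercShatteringRace. [folklore] -/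
theorem percolationContinuityZ3_of_powerSaving_of_pairTwoArmsDecay
    (hS : Summit.CriticalPhenomena.PercolationContinuityZ3.Theses.PercShatteringRace.FreeSusceptibilityPowerSaving)
    (h₁ : ∀ ε : ℝ, 0 < ε → ∀ᶠ n : ℕ in Filter.atTop, ∀ x ∈ box 3 n, ∀ x' ∈ box 3 n,
      (bondPercolation (zdGraph 3) (criticalProbI 3)).real
        {ω | ∃ y ∈ innerBoundary (zdGraph 3) (box 3 ⌈(n : ℝ) ^ ((7 : ℝ) / 6)⌉₊),
          ∃ y' ∈ innerBoundary (zdGraph 3) (box 3 ⌈(n : ℝ) ^ ((7 : ℝ) / 6)⌉₊),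
            ω ∈ openConnIn ↑(box 3 ⌈(n : ℝ) ^ ((7 : ℝ) / 6)⌉₊) x y ∧
            ω ∈ openConnIn ↑(box 3 ⌈(n : ℝ) ^ ((7 : ℝ) / 6)⌉₊) x' y' ∧
            ω ∉ openConnIn ↑(box 3 ⌈(n : ℝ) ^ ((7 : ℝ) / 6)⌉₊) x x'} ≤ ε) :
    _root_.PercolationContinuityZ3 := by
  have h := raceLemma_of_jumpBoxLRO (1 / 2) (1 / 6) (by norm_num) (by norm_num)
  have e1 : (3 : ℝ) - 1 / 2 = 5 / 2 := by norm_num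
  rw [e1] at h
  exact h hS (jumpBoxLRO_of_pairDecay (pairDecay_iff.2 h₁))

/-- **Necessity of child 1**: the crux (union form) implies `PairTwoArmsDecay` (pair form). [folklore] -/
theorem pairTwoArmsDecay_of_nearLinearTwoClusterDecay (h : NearLinearTwoClusterDecay) :
    ∀ ε : ℝ, 0 < ε → ∀ᶠ n : ℕ in Filter.atTop, ∀ x ∈ box 3 n, ∀ x' ∈ box 3 n,
      (bondPercolation (zdGraph 3) (criticalProbI 3)).real
        {ω | ∃ y ∈ innerBoundary (zdGraph 3) (box 3 ⌈(n : ℝ) ^ ((7 : ℝ) / 6)⌉₊),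
          ∃ y' ∈ innerBoundary (zdGraph 3) (box 3 ⌈(n : ℝ) ^ ((7 : ℝ) / 6)⌉₊),
            ω ∈ openConnIn ↑(box 3 ⌈(n : ℝ) ^ ((7 : ℝ) / 6)⌉₊) x y ∧
            ω ∈ openConnIn ↑(box 3 ⌈(n : ℝ) ^ ((7 : ℝ) / 6)⌉₊) x' y' ∧
            ω ∉ openConnIn ↑(box 3 ⌈(n : ℝ) ^ ((7 : ℝ) / 6)⌉₊) x x'} ≤ ε :=
  pairDecay_iff.1 (pairDecay_of_tendsto (nearLinearTwoClusterDecay_iff_twoCluster.1 h))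

/-- **The lossless alternative cut**: `PairTwoArmsDecay → NoThinWitness → NearLinearTwoClusterDecay`,
where `NoThinWitness` says that in a two-distinct-clusters configuration no witness is `κ`-thin in
`Λ(n)`.  Same density-sampling glue. [folklore] -/
theorem nearLinearTwoClusterDecay_of_pairTwoArmsDecay_of_noThinWitness
    (h₁ : ∀ ε : ℝ, 0 < ε → ∀ᶠ n : ℕ in Filter.atTop, ∀ x ∈ box 3 n, ∀ x' ∈ box 3 n,
      (bondPercolation (zdGraph 3) (criticalProbI 3)).real
        {ω | ∃ y ∈ innerBoundary (zdGraph 3) (box 3 ⌈(n : ℝ) ^ ((7 : ℝ) / 6)⌉₊),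
          ∃ y' ∈ innerBoundary (zdGraph 3) (box 3 ⌈(n : ℝ) ^ ((7 : ℝ) / 6)⌉₊),
            ω ∈ openConnIn ↑(box 3 ⌈(n : ℝ) ^ ((7 : ℝ) / 6)⌉₊) x y ∧
            ω ∈ openConnIn ↑(box 3 ⌈(n : ℝ) ^ ((7 : ℝ) / 6)⌉₊) x' y' ∧
            ω ∉ openConnIn ↑(box 3 ⌈(n : ℝ) ^ ((7 : ℝ) / 6)⌉₊) x x'} ≤ ε)
    (h₂ : ∀ ε : ℝ, 0 < ε → ∃ κ : ℝ, 0 < κ ∧ ∀ᶠ n : ℕ in Filter.atTop,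
      (bondPercolation (zdGraph 3) (criticalProbI 3)).real
        {ω | ∃ x ∈ box 3 n, ∃ x' ∈ box 3 n,
          (∃ y ∈ innerBoundary (zdGraph 3) (box 3 ⌈(n : ℝ) ^ ((7 : ℝ) / 6)⌉₊),
            ∃ y' ∈ innerBoundary (zdGraph 3) (box 3 ⌈(n : ℝ) ^ ((7 : ℝ) / 6)⌉₊),
              ω ∈ openConnIn ↑(box 3 ⌈(n : ℝ) ^ ((7 : ℝ) / 6)⌉₊) x y ∧
              ω ∈ openConnIn ↑(box 3 ⌈(n : ℝ) ^ ((7 : ℝ) / 6)⌉₊) x' y' ∧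
              ω ∉ openConnIn ↑(box 3 ⌈(n : ℝ) ^ ((7 : ℝ) / 6)⌉₊) x x') ∧
          (Set.ncard {z : Site 3 | z ∈ box 3 n ∧
              ω ∈ openConnIn ↑(box 3 ⌈(n : ℝ) ^ ((7 : ℝ) / 6)⌉₊) x z} : ℝ) < κ * (box 3 n).card} ≤ ε) :
    Summit.CriticalPhenomena.PercolationContinuityZ3.Theses.PercShatteringRace.NearLinearTwoClusterDecay := by
  have h1 := pairDecay_iff.2 h₁
  have h2 : ∀ ε : ℝ, 0 < ε → ∃ κ : ℝ, 0 < κ ∧ ∀ᶠ n : ℕ in atTop, Pc.real (thinWitnessEvt n (outer n) κ) ≤ ε := by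
    intro ε hε
    obtain ⟨κ, hκ, hev⟩ := h₂ ε hε
    refine ⟨κ, hκ, ?_⟩
    filter_upwards [hev] with n hn
    rwa [thinWitnessEvt_eq]
  exact nearLinearTwoClusterDecay_iff_twoCluster.2 (tendsto_twoCluster_of_pairDecay_of_noThinWitness' h1 h2)

/-- **Losslessness of the alternative cut**: `U ↔ PairTwoArmsDecay ∧ NoThinWitness`. [folklore] -/
theorem nearLinearTwoClusterDecay_iff_pair_and_noThinWitness :
    NearLinearTwoClusterDecay ↔
    ((∀ ε : ℝ, 0 < ε → ∀ᶠ n : ℕ in Filter.atTop, ∀ x ∈ box 3 n, ∀ x' ∈ box 3 n,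
      (bondPercolation (zdGraph 3) (criticalProbI 3)).real
        {ω | ∃ y ∈ innerBoundary (zdGraph 3) (box 3 ⌈(n : ℝ) ^ ((7 : ℝ) / 6)⌉₊),
          ∃ y' ∈ innerBoundary (zdGraph 3) (box 3 ⌈(n : ℝ) ^ ((7 : ℝ) / 6)⌉₊),
            ω ∈ openConnIn ↑(box 3 ⌈(n : ℝ) ^ ((7 : ℝ) / 6)⌉₊) x y ∧
            ω ∈ openConnIn ↑(box 3 ⌈(n : ℝ) ^ ((7 : ℝ) / 6)⌉₊) x' y' ∧
            ω ∉ openConnIn ↑(box 3 ⌈(n : ℝ) ^ ((7 : ℝ) / 6)⌉₊) x x'} ≤ ε) ∧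
    (∀ ε : ℝ, 0 < ε → ∃ κ : ℝ, 0 < κ ∧ ∀ᶠ n : ℕ in Filter.atTop,
      (bondPercolation (zdGraph 3) (criticalProbI 3)).real
        {ω | ∃ x ∈ box 3 n, ∃ x' ∈ box 3 n,
          (∃ y ∈ innerBoundary (zdGraph 3) (box 3 ⌈(n : ℝ) ^ ((7 : ℝ) / 6)⌉₊),
            ∃ y' ∈ innerBoundary (zdGraph 3) (box 3 ⌈(n : ℝ) ^ ((7 : ℝ) / 6)⌉₊),
              ω ∈ openConnIn ↑(box 3 ⌈(n : ℝ) ^ ((7 : ℝ) / 6)⌉₊) x y ∧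
              ω ∈ openConnIn ↑(box 3 ⌈(n : ℝ) ^ ((7 : ℝ) / 6)⌉₊) x' y' ∧
              ω ∉ openConnIn ↑(box 3 ⌈(n : ℝ) ^ ((7 : ℝ) / 6)⌉₊) x x') ∧
          (Set.ncard {z : Site 3 | z ∈ box 3 n ∧
              ω ∈ openConnIn ↑(box 3 ⌈(n : ℝ) ^ ((7 : ℝ) / 6)⌉₊) x z} : ℝ) < κ * (box 3 n).card} ≤ ε)) := by
  constructor
  · intro h
    refine ⟨pairTwoArmsDecay_of_nearLinearTwoClusterDecay h, ?_⟩
    intro ε hε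
    obtain ⟨κ, hκ, hev⟩ := noThinWitness'_of_tendsto (nearLinearTwoClusterDecay_iff_twoCluster.1 h) ε hε
    refine ⟨κ, hκ, ?_⟩
    filter_upwards [hev] with n hn
    rwa [← thinWitnessEvt_eq]
  · rintro ⟨h₁, h₂⟩
    exact nearLinearTwoClusterDecay_of_pairTwoArmsDecay_of_noThinWitness h₁ h₂

/-- **Child 2 implies the lossless residue** (`LongArmsAreDense → NoThinWitness`): the filed cut is
the lossless cut strengthened on the second factor only (one thin ARM instead of one thin WITNESS
of a bad pair). [folklore] -/
theorem noThinWitness_of_longArmsAreDense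
    (h₂ : ∀ ε : ℝ, 0 < ε → ∃ κ : ℝ, 0 < κ ∧ ∀ᶠ n : ℕ in Filter.atTop,
      (bondPercolation (zdGraph 3) (criticalProbI 3)).real
        {ω | ∃ x ∈ box 3 n,
          (∃ y ∈ innerBoundary (zdGraph 3) (box 3 ⌈(n : ℝ) ^ ((7 : ℝ) / 6)⌉₊),
            ω ∈ openConnIn ↑(box 3 ⌈(n : ℝ) ^ ((7 : ℝ) / 6)⌉₊) x y) ∧
          (Set.ncard {z : Site 3 | z ∈ box 3 n ∧
              ω ∈ openConnIn ↑(box 3 ⌈(n : ℝ) ^ ((7 : ℝ) / 6)⌉₊) x z} : ℝ) < κ * (box 3 n).card} ≤ ε) :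
    ∀ ε : ℝ, 0 < ε → ∃ κ : ℝ, 0 < κ ∧ ∀ᶠ n : ℕ in Filter.atTop,
      (bondPercolation (zdGraph 3) (criticalProbI 3)).real
        {ω | ∃ x ∈ box 3 n, ∃ x' ∈ box 3 n,
          (∃ y ∈ innerBoundary (zdGraph 3) (box 3 ⌈(n : ℝ) ^ ((7 : ℝ) / 6)⌉₊),
            ∃ y' ∈ innerBoundary (zdGraph 3) (box 3 ⌈(n : ℝ) ^ ((7 : ℝ) / 6)⌉₊),
              ω ∈ openConnIn ↑(box 3 ⌈(n : ℝ) ^ ((7 : ℝ) / 6)⌉₊) x y ∧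
              ω ∈ openConnIn ↑(box 3 ⌈(n : ℝ) ^ ((7 : ℝ) / 6)⌉₊) x' y' ∧
              ω ∉ openConnIn ↑(box 3 ⌈(n : ℝ) ^ ((7 : ℝ) / 6)⌉₊) x x') ∧
          (Set.ncard {z : Site 3 | z ∈ box 3 n ∧
              ω ∈ openConnIn ↑(box 3 ⌈(n : ℝ) ^ ((7 : ℝ) / 6)⌉₊) x z} : ℝ) < κ * (box 3 n).card} ≤ ε := by
  have h2 : ∀ ε : ℝ, 0 < ε → ∃ κ : ℝ, 0 < κ ∧ ∀ᶠ n : ℕ in atTop, Pc.real (thinEvt n (outer n) κ) ≤ ε := by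
    intro ε hε
    obtain ⟨κ, hκ, hev⟩ := h₂ ε hε
    refine ⟨κ, hκ, ?_⟩
    filter_upwards [hev] with n hn
    rwa [thinEvt_eq]
  intro ε hε
  obtain ⟨κ, hκ, hev⟩ := noThinWitness'_of_longArmsDense' h2 ε hε
  refine ⟨κ, hκ, ?_⟩
  filter_upwards [hev] with n hn
  rwa [← thinWitnessEvt_eq]

end Summit.CriticalPhenomena.PercolationContinuityZ3.Theorems
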